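import Literature.Analysis.SpecialFunctions.DigammaLogBound
import Literature.Analysis.SpecialFunctions.PolygammaSeries
import Mathlib.Analysis.Real.Pi.Bounds
import HarnessLib

/-!
# Format C analysis layer (D2): `|ψ′(w)| ≤ 1/‖w‖² + π/(2|Im w|)` on the right half-plane

Route context: Fourier–Galerkin / Schur-complement certificates of Weil positivity on a window ("format C";
cell memo `run/shared/lean/pub/rh-explicit/rh-explicit-weil-10/FORMATC-DESIGN.md` §4.1 (D2); sibling
`WeilFormatCDigammaEdgeBounds.lean` = (D1); supporting stmt-RiemannHypothesis-0098).  The diagonal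
archimedean Gram entry of Weil's functional in the window's Fourier basis carries `Re ψ′(¼ + iω_n/2)/(4a)`
[Yoshida 1992, (5.15)]; the far-coercivity lemma (L-C3a) needs only that this is `O(1/ω_n)` with an explicit
constant.  From the polygamma series `ψ′(w) = Σ_{j≥0} (w+j)⁻²`
(`Literature.Analysis.SpecialFunctions.Complex.hasSum_iteratedDeriv_digamma`) and the tree's
`Σ_j ‖w+j‖⁻² ≤ ‖w‖⁻² + π/(2|Im w|)` (`tsum_inv_norm_add_sq_le`):

* `WeilFormatC.norm_deriv_digamma_le` — **`‖ψ′(w)‖ ≤ 1/‖w‖² + π/(2|Im w|)`** for `0 < Re w`, `Im w ≠ 0`;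
* `WeilFormatC.norm_deriv_digamma_le_two_div` — for `0 < Re w` and `12/5 ≤ |Im w|`: **`‖ψ′(w)‖ ≤ 2/|Im w|`**
  (the form (D2) used by the certificates: `1/y² ≤ (5/12)/y` and `5/12 + π/2 ≤ 2`).

Pure special-function analysis; standard axioms; nothing Weil-specific is defined here.
-/

-- `Summit.RiemannHypothesis.RiemannHypothesis.…` is the layout-mandated namespace (summit = problem name).
set_option linter.dupNamespace false

noncomputable section

open Filter
open scoped Real Topology

namespace Summit.RiemannHypothesis.RiemannHypothesis.Theorems.WeilFormatC

open Complex Literature.Analysis.SpecialFunctions.Complex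

/-- **`‖ψ′(w)‖ ≤ 1/‖w‖² + π/(2|Im w|)`** for `0 < Re w`, `Im w ≠ 0`: the polygamma series
`ψ′(w) = Σ_j (w+j)⁻²` is dominated termwise by `Σ_j ‖w+j‖⁻²`. -/
theorem norm_deriv_digamma_le {w : ℂ} (hw : 0 < w.re) (hy : w.im ≠ 0) :
    ‖deriv digamma w‖ ≤ 1 / ‖w‖ ^ 2 + π / (2 * |w.im|) := by
  have h := hasSum_iteratedDeriv_digamma hw (k := 1) le_rfl
  rw [iteratedDeriv_one] at h
  have h' : HasSum (fun j : ℕ ↦ ((w + j) ^ 2)⁻¹) (deriv digamma w) := by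
    refine h.congr_fun fun j ↦ ?_
    simp
  -- termwise norms
  have hnorm : ∀ j : ℕ, ‖((w + j) ^ 2)⁻¹‖ = 1 / ‖w + j‖ ^ 2 := fun j ↦ by
    rw [norm_inv, norm_pow, one_div]
  have hsum : Summable fun j : ℕ ↦ 1 / ‖w + (j : ℂ)‖ ^ 2 := by
    have := h'.summable.norm
    exact this.congr hnorm
  calc ‖deriv digamma w‖ = ‖∑' j : ℕ, ((w + j) ^ 2)⁻¹‖ := by rw [h'.tsum_eq]
    _ ≤ ∑' j : ℕ, ‖((w + (j : ℂ)) ^ 2)⁻¹‖ := norm_tsum_le_tsum_norm h'.summable.norm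
    _ = ∑' j : ℕ, 1 / ‖w + (j : ℂ)‖ ^ 2 := tsum_congr hnorm
    _ ≤ 1 / ‖w‖ ^ 2 + π / (2 * |w.im|) := tsum_inv_norm_add_sq_le hw hy

/-- **(D2)** For `0 < Re w` and `12/5 ≤ |Im w|`: `‖ψ′(w)‖ ≤ 2/|Im w|`.  In the certificates this is used at
`w = ¼ + iω/2`, `ω ≥ 24/5`, as `|Re ψ′(¼ + iω/2)|/(4a) ≤ 1/(aω)`. -/
theorem norm_deriv_digamma_le_two_div {w : ℂ} (hw : 0 < w.re) (hy : 12 / 5 ≤ |w.im|) :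
    ‖deriv digamma w‖ ≤ 2 / |w.im| := by
  have hy0 : 0 < |w.im| := lt_of_lt_of_le (by norm_num) hy
  have hyne : w.im ≠ 0 := abs_pos.mp hy0
  have h := norm_deriv_digamma_le hw hyne
  -- `1/‖w‖² ≤ 1/|Im w|² ≤ (5/12)/|Im w|`
  have hn : |w.im| ^ 2 ≤ ‖w‖ ^ 2 := by
    rw [sq_abs, Complex.sq_norm, Complex.normSq_apply]
    nlinarith [sq_nonneg w.re]
  have h1 : 1 / ‖w‖ ^ 2 ≤ 1 / |w.im| ^ 2 := one_div_le_one_div_of_le (by positivity) hn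
  have h2 : 1 / |w.im| ^ 2 ≤ (5 / 12) / |w.im| := by
    rw [div_le_div_iff₀ (by positivity) hy0]
    nlinarith
  have h3 : π / (2 * |w.im|) ≤ (19 / 12) / |w.im| := by
    rw [div_le_div_iff₀ (by positivity) hy0]
    nlinarith [Real.pi_lt_d2]
  have h4 : (5 / 12) / |w.im| + (19 / 12) / |w.im| = 2 / |w.im| := by ring
  linarith

end Summit.RiemannHypothesis.RiemannHypothesis.Theorems.WeilFormatC
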